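import Literature.Computability.Complexity.PEASigmaTwoFPLeaves
import HarnessLib

/-!
# Entropy approximation in `Σ₂ᵖ`, VIII: the matrix program is polynomial time on codes

Eighth file of the proof of `PEA d ∈ promiseLift (SigmaP 2)` (program: `PEASigmaTwoProgram.lean`,
leaves: `PEASigmaTwoFPLeaves.lean`).  We finish the `CodeFP` certificate of the program:

* the parameters `pT, pN, pR, pM, pt, pL, pK` in unary from `n'` (unary) and `k` (binary);
* `usedVarsFP`, `nVarsFP`, `renameFP` — the renaming of the occurring variables, from the code of an
  erased instance (`shE`, which is the Boolean code `PEAInst.encoding` of the instance,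
  `encode_eq_shE`);
* `matCoreE` and **`matPFP : CodeFP frameE bitE (matP on frames)`** — the matrix of the `Σ₂ᵖ`
  predicate, on frames `⟨⟨⟨instance, h⟩, v⟩, u⟩`, is computed by a polynomial-time string function.

## References

* S. Arora, B. Barak, *Computational Complexity: A Modern Approach*, CUP 2009, §1.3.
* M. Sipser, STOC 1983, §V.
-/

namespace Literature.Computability.Complexity

open _root_.Computability CodeFP

namespace PEAHash

variable {θ : Type} {eθ : θ → List Bool}

/-! ### The parameters in unary -/

section Params

variable {fn fk : θ → ℕ}

/-- `T = 128 n'²` in unary. [folklore] -/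
theorem pTE (hn : CodeFP eθ unE fn) : CodeFP eθ unE (fun x => pT (fn x)) :=
  (unMulE (unConstE 128) (unMulE hn hn)).congr fun x => by rw [pT, sq]

/-- `N = T n'` in unary. [folklore] -/
theorem pNE (hn : CodeFP eθ unE fn) : CodeFP eθ unE (fun x => pN (fn x)) := unMulE (pTE hn) hn

/-- `n' - min k n' = n' - k`. [folklore] -/
theorem sub_min_self (n k : ℕ) : n - min k n = n - k := by
  rcases le_total k n with h | h
  · rw [min_eq_left h]
  · rw [min_eq_right h, Nat.sub_self, Nat.sub_eq_zero_of_le h]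

/-- `r = T(n' - k) - T/2` in unary (`k` binary, converted under the cap `n'`). [folklore] -/
theorem pRE (hn : CodeFP eθ unE fn) (hk : CodeFP eθ natE fk) : CodeFP eθ unE (fun x => pR (fn x) (fk x)) := by
  have hkmin : CodeFP eθ unE (fun x => min (fk x) (fn x)) := unOfNatMin.comp (hn.pair hk)
  refine (unSubE (unMulE (pTE hn) (unSubE hn hkmin)) (unMulE (unConstE 64) (unMulE hn hn))).congr fun x => ?_
  rw [sub_min_self, pR, pT]
  congr 1
  rw [show 128 * fn x ^ 2 / 2 = 64 * (fn x * fn x) by rw [sq]; omega]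

/-- `M = N + (rN + r)` in unary. [folklore] -/
theorem pME (hn : CodeFP eθ unE fn) (hk : CodeFP eθ natE fk) : CodeFP eθ unE (fun x => pM (fn x) (fk x)) :=
  (unAddE (pNE hn) (unAddE (unMulE (pRE hn hk) (pNE hn)) (pRE hn hk))).congr fun _ => rfl

/-- `t = M + 5` in unary. [folklore] -/
theorem ptE (hn : CodeFP eθ unE fn) (hk : CodeFP eθ natE fk) : CodeFP eθ unE (fun x => pt (fn x) (fk x)) :=
  (unAddE (pME hn hk) (unConstE 5)).congr fun _ => rfl

/-- `L = t M` in unary. [folklore] -/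
theorem pLE (hn : CodeFP eθ unE fn) (hk : CodeFP eθ natE fk) : CodeFP eθ unE (fun x => pL (fn x) (fk x)) :=
  unMulE (ptE hn hk) (pME hn hk)

/-- `κ = t(M - 1)` in unary. [folklore] -/
theorem pKE (hn : CodeFP eθ unE fn) (hk : CodeFP eθ natE fk) : CodeFP eθ unE (fun x => pK (fn x) (fk x)) :=
  (unMulE (ptE hn hk) (unSubE (pME hn hk) (unConstE 1))).congr fun _ => rfl

end Params

/-! ### The renaming on codes -/

section Rename

/-- The Boolean code of an erased instance (`PEAInst.encoding`, see `encode_eq_shE`). [folklore] -/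
abbrev shE : Shadow → List Bool := pairE natE (pairE (listE (listE (listE natE))) natE)

/-- The frames `⟨⟨⟨instance, h⟩, v⟩, u⟩` of the `Σ₂ᵖ` predicate. [folklore] -/
abbrev frameE : ((Shadow × List Bool) × List Bool) × List Bool → List Bool :=
  pairE (pairE (pairE shE strE) strE) strE

/-- The sparse map of an instance as raw nested lists (drop the three unary length headers). [folklore] -/
theorem mapRawFP : CodeFP shE (rawE (rawE (rawE natE))) (fun s => s.2.1) := by
  have h1 : CodeFP (listE (listE (listE natE))) (rawE (listE (listE natE))) id := rawOfList _
  have h2 : CodeFP (rawE (listE (listE natE))) (rawE (rawE (listE natE))) (fun l => l.map id) := map₀ (rawOfList _)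
  have h3 : CodeFP (rawE (rawE (listE natE))) (rawE (rawE (rawE natE))) (fun l => l.map fun p => p.map id) :=
    map₀ (map₀ (rawOfList _))
  exact ((h3.comp (h2.comp h1)).comp (snd _ _).fst').congr fun s => by simp

/-- `usedVars` on codes. [cite: AroraBarak2009, §1.3] -/
theorem usedVarsFP : CodeFP shE (rawE natE) (fun s => usedVars s.2.1) :=
  ((dedup natE natE_injective).comp ((flatten natE).comp ((flatten (rawE natE)).comp mapRawFP))).congr fun _ => rfl

/-- `nVars` on codes, in unary. [cite: AroraBarak2009, §1.3] -/
theorem nVarsFP : CodeFP shE unE (fun s => nVars s.2.1) := ((ulength natE).comp usedVarsFP).congr fun _ => rfl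

/-- The position of an index in a list of indices (`List.idxOf`). [folklore] -/
theorem idxOfFP : CodeFP (pairE (rawE natE) natE) natE (fun q => q.1.idxOf q.2) := by
  have hp : CodeFP (pairE natE natE) bitE (fun t => t.2 == t.1) := (beq natE_injective).comp ((snd _ _).pair (fst _ _))
  exact ((findIdxFP hp).comp ((snd _ _).pair (fst _ _))).congr fun _ => rfl

/-- **`rename` on codes**: three nested maps with the list of used variables as context. [cite: AroraBarak2009, §1.3] -/
theorem renameFP : CodeFP shE (rawE (rawE (rawE natE))) (fun s => rename s.2.1) := by
  have hA : CodeFP (pairE (rawE natE) (rawE natE)) (rawE natE) (fun q => q.2.map fun i => q.1.idxOf i) := map idxOfFP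
  have hB : CodeFP (pairE (rawE natE) (rawE (rawE natE))) (rawE (rawE natE))
      (fun q => q.2.map fun μ => μ.map fun i => q.1.idxOf i) := map hA
  have hC : CodeFP (pairE (rawE natE) (rawE (rawE (rawE natE)))) (rawE (rawE (rawE natE)))
      (fun q => q.2.map fun p => p.map fun μ => μ.map fun i => q.1.idxOf i) := map hB
  exact (hC.comp (usedVarsFP.pair mapRawFP)).congr fun _ => rfl

end Rename

/-! ### The matrix -/

section Matrix

variable {fQ : θ → List (List (List ℕ))} {fn fk : θ → ℕ} {fh fv fu : θ → List Bool}

/-- **`matCore` on codes**, for computed map (raw), `n'` (unary), `k` (binary) and strings `h, v, u`.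
[cite: Sipser1983, §V] [cite: AroraBarak2009, §1.3] -/
theorem matCoreE (hQ : CodeFP eθ (rawE (rawE (rawE natE))) fQ) (hn : CodeFP eθ unE fn) (hk : CodeFP eθ natE fk)
    (hh : CodeFP eθ strE fh) (hv : CodeFP eθ strE fv) (hu : CodeFP eθ strE fu) :
    CodeFP eθ bitE (fun x => matCore (fQ x) (fn x) (fk x) (fh x) (fv x) (fu x)) := by
  -- parameters
  have hT := pTE hn
  have hN := pNE hn
  have hr := pRE hn hk
  have hM := pME hn hk
  have ht := ptE hn hk
  have hL := pLE hn hk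
  have hK := pKE hn hk
  -- guard
  have hguard : CodeFP eθ bitE (fun x => decide (fk x < fn x)) := natLt.comp (hk.pair (natOfUn.comp hn))
  -- the candidate `y`
  have hy : CodeFP eθ strE (fun x => sliceD (fv x) 0 (pL (fn x) (fk x))) := sliceE hv (unConstE 0) hL
  have hnot0 : CodeFP eθ bitE (fun x => notInX (fQ x) (fn x) (pT (fn x)) (pN (fn x)) (pR (fn x) (fk x))
      (pM (fn x) (fk x)) (pt (fn x) (fk x)) (sliceD (fv x) 0 (pL (fn x) (fk x))) (fu x) 0) :=
    notInXE hQ hn hT hN hr hM ht hy hu (unConstE 0)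
  -- environment `(x, a)` of the loop over the matrices
  have u1 {e : θ → ℕ} (h : CodeFP eθ unE e) : CodeFP (pairE eθ unE) unE (fun q => e q.1) := h.comp (fst _ _)
  have s1 {e : θ → List Bool} (h : CodeFP eθ strE e) : CodeFP (pairE eθ unE) strE (fun q => e q.1) := h.comp (fst _ _)
  have ha : CodeFP (pairE eθ unE) unE (fun q => q.2) := snd _ _
  have hoffZ : CodeFP (pairE eθ unE) unE (fun q => (q.2 + 1) * pL (fn q.1) (fk q.1)) := unMulE (unAddE ha (unConstE 1)) (u1 hL)
  have hZ : CodeFP (pairE eθ unE) strE (fun q => sliceD (fv q.1) ((q.2 + 1) * pL (fn q.1) (fk q.1)) (pL (fn q.1) (fk q.1))) :=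
    sliceE (s1 hv) hoffZ (u1 hL)
  have hy1 : CodeFP (pairE eθ unE) strE (fun q => sliceD (fv q.1) 0 (pL (fn q.1) (fk q.1))) := hy.comp (fst _ _)
  have hnotZ : CodeFP (pairE eθ unE) bitE (fun q => notInX (fQ q.1) (fn q.1) (pT (fn q.1)) (pN (fn q.1)) (pR (fn q.1) (fk q.1))
      (pM (fn q.1) (fk q.1)) (pt (fn q.1) (fk q.1)) (sliceD (fv q.1) ((q.2 + 1) * pL (fn q.1) (fk q.1)) (pL (fn q.1) (fk q.1)))
      (fu q.1) (q.2 + 1)) :=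
    notInXE (hQ.comp (fst _ _)) (u1 hn) (u1 hT) (u1 hN) (u1 hr) (u1 hM) (u1 ht) hZ (s1 hu) (unAddE ha (unConstE 1))
  have heqZ : CodeFP (pairE eθ unE) bitE (fun q =>
      sliceD (fv q.1) ((q.2 + 1) * pL (fn q.1) (fk q.1)) (pL (fn q.1) (fk q.1)) == sliceD (fv q.1) 0 (pL (fn q.1) (fk q.1))) :=
    (beq (fun _ _ h => h)).comp (hZ.pair hy1)
  -- environment `((x, a), ρ)` of the loop over the rows
  have hρ : CodeFP (pairE (pairE eθ unE) unE) unE (fun q => q.2) := snd _ _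
  have ha2 : CodeFP (pairE (pairE eθ unE) unE) unE (fun q => q.1.2) := (fst _ _).snd'
  have u2 {e : θ → ℕ} (h : CodeFP eθ unE e) : CodeFP (pairE (pairE eθ unE) unE) unE (fun q => e q.1.1) := h.comp (fst _ _).fst'
  have hoffH : CodeFP (pairE (pairE eθ unE) unE) unE
      (fun q => (q.1.2 * pK (fn q.1.1) (fk q.1.1) + q.2) * pL (fn q.1.1) (fk q.1.1)) :=
    unMulE (unAddE (unMulE ha2 (u2 hK)) hρ) (u2 hL)
  have hrowH : CodeFP (pairE (pairE eθ unE) unE) strE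
      (fun q => sliceD (fh q.1.1) ((q.1.2 * pK (fn q.1.1) (fk q.1.1) + q.2) * pL (fn q.1.1) (fk q.1.1)) (pL (fn q.1.1) (fk q.1.1))) :=
    sliceE (hh.comp (fst _ _).fst') hoffH (u2 hL)
  have hZ2 : CodeFP (pairE (pairE eθ unE) unE) strE
      (fun q => sliceD (fv q.1.1) ((q.1.2 + 1) * pL (fn q.1.1) (fk q.1.1)) (pL (fn q.1.1) (fk q.1.1))) := hZ.comp (fst _ _)
  have hy2 : CodeFP (pairE (pairE eθ unE) unE) strE (fun q => sliceD (fv q.1.1) 0 (pL (fn q.1.1) (fk q.1.1))) := hy1.comp (fst _ _)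
  have hrowbody : CodeFP (pairE (pairE eθ unE) unE) bitE (fun q =>
      dotB (sliceD (fh q.1.1) ((q.1.2 * pK (fn q.1.1) (fk q.1.1) + q.2) * pL (fn q.1.1) (fk q.1.1)) (pL (fn q.1.1) (fk q.1.1)))
          (sliceD (fv q.1.1) ((q.1.2 + 1) * pL (fn q.1.1) (fk q.1.1)) (pL (fn q.1.1) (fk q.1.1))) !=
        dotB (sliceD (fh q.1.1) ((q.1.2 * pK (fn q.1.1) (fk q.1.1) + q.2) * pL (fn q.1.1) (fk q.1.1)) (pL (fn q.1.1) (fk q.1.1)))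
          (sliceD (fv q.1.1) 0 (pL (fn q.1.1) (fk q.1.1)))) :=
    ((beq bitE_injective).comp ((dotBE hrowH hZ2).pair (dotBE hrowH hy2))).not.congr fun _ => rfl
  have hrows : CodeFP (pairE eθ unE) bitE (fun q => (List.range (pK (fn q.1) (fk q.1))).any fun ρ =>
      dotB (sliceD (fh q.1) ((q.2 * pK (fn q.1) (fk q.1) + ρ) * pL (fn q.1) (fk q.1)) (pL (fn q.1) (fk q.1)))
          (sliceD (fv q.1) ((q.2 + 1) * pL (fn q.1) (fk q.1)) (pL (fn q.1) (fk q.1))) !=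
        dotB (sliceD (fh q.1) ((q.2 * pK (fn q.1) (fk q.1) + ρ) * pL (fn q.1) (fk q.1)) (pL (fn q.1) (fk q.1)))
          (sliceD (fv q.1) 0 (pL (fn q.1) (fk q.1)))) :=
    anyE (LLLFactoring.urangeUn.comp (u1 hK)) hrowbody
  have hbodyA : CodeFP (pairE eθ unE) bitE (fun q =>
      notInX (fQ q.1) (fn q.1) (pT (fn q.1)) (pN (fn q.1)) (pR (fn q.1) (fk q.1)) (pM (fn q.1) (fk q.1)) (pt (fn q.1) (fk q.1))
          (sliceD (fv q.1) ((q.2 + 1) * pL (fn q.1) (fk q.1)) (pL (fn q.1) (fk q.1))) (fu q.1) (q.2 + 1) ||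
        (sliceD (fv q.1) ((q.2 + 1) * pL (fn q.1) (fk q.1)) (pL (fn q.1) (fk q.1)) == sliceD (fv q.1) 0 (pL (fn q.1) (fk q.1))) ||
        (List.range (pK (fn q.1) (fk q.1))).any fun ρ =>
          dotB (sliceD (fh q.1) ((q.2 * pK (fn q.1) (fk q.1) + ρ) * pL (fn q.1) (fk q.1)) (pL (fn q.1) (fk q.1)))
              (sliceD (fv q.1) ((q.2 + 1) * pL (fn q.1) (fk q.1)) (pL (fn q.1) (fk q.1))) !=
            dotB (sliceD (fh q.1) ((q.2 * pK (fn q.1) (fk q.1) + ρ) * pL (fn q.1) (fk q.1)) (pL (fn q.1) (fk q.1)))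
              (sliceD (fv q.1) 0 (pL (fn q.1) (fk q.1)))) :=
    (hnotZ.or heqZ).or hrows
  have hloopA := anyE (LLLFactoring.urangeUn.comp hK) hbodyA
  exact (hguard.and (hnot0.or hloopA)).congr fun _ => rfl

/-- **The matrix of the `Σ₂ᵖ` predicate is polynomial time on frames**: `matP` on
`⟨⟨⟨erased instance, h⟩, v⟩, u⟩`. [cite: Sipser1983, §V] [cite: AroraBarak2009, §1.3] -/
theorem matPFP : CodeFP frameE bitE (fun f => matP f.1.1.1 f.1.1.2 f.1.2 f.2) := by
  have hs : CodeFP frameE shE (fun f => f.1.1.1) := ((fst _ _).fst').fst'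
  exact (matCoreE (renameFP.comp hs) (nVarsFP.comp hs) (((snd _ _).snd').comp hs) ((fst _ _).fst').snd'
    (fst _ _).snd' (snd _ _)).congr fun _ => rfl

end Matrix

/-! ### The frame of a genuine instance -/

/-- **The Boolean code of a `PEA` instance is the code of its erasure.** [folklore] -/
theorem encode_eq_shE (I : PEAInst) : PEAInst.encoding.encode I = shE (erase I) := by
  obtain ⟨n, P, k⟩ := I
  change boolPair (encodeNat n) (boolPair ((PolyMapF2.encoding n).encode P) (encodeNat k)) = _
  simp only [shE, pairE_apply, erase]
  congr 2
  rw [PolyMapF2.encoding, listE_eq, listE_eq, listE_eq, Literature.Computability.QuantumComplexity.listE_map]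
  congr 1
  funext p
  show _ = listE (listE natE) (p.map (List.map Fin.val))
  rw [Literature.Computability.QuantumComplexity.listE_map]
  congr 1
  funext μ
  show _ = listE natE (μ.map Fin.val)
  rw [Literature.Computability.QuantumComplexity.listE_map]
  rfl

end PEAHash

end Literature.Computability.Complexity
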